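import Summits.AtomisticToContinuum.HydrodynamicLimit.Theorems.TwoClocksClampedWindowDockGronwall
import Summits.AtomisticToContinuum.HydrodynamicLimit.Theorems.OneFlightGossipEngineUniformLocalGibbsConcentration
import Summits.AtomisticToContinuum.HydrodynamicLimit.Theorems.LambertianContactSwapSwapGapRelEntSwapTimeZero
import Literature.MathematicalPhysics.KineticTheory.LambertianRedrawNondegenerate
import Literature.Analysis.FunctionSpaces.TorusCalculusProofs
import HarnessLib

/-!
# `LambertianEuler` (stmt-AtomisticToContinuum-11854), line `Sketch`: the entropy-clock DOCK for the Lambertian gas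

Stub `stub_dockLambda` of skeleton v10 of the crux `LambertianEuler` (Euler hydrodynamic limit of the
Lambertian hard-sphere gas `Λ`, law of `Λ_t` under `λ_N ⊗ γ^ℕ`). The node `RelEntropyVanishingLambda`
(Yau's relative-entropy node for `Λ`: the local Gibbs laws are probability measures; given the `t = 0`
tie, for every `t < T` an activity profile `a` whose local Gibbs law with `(u t, θ t)` is a probability
measure, concentrates exponentially around the Euler fields `(ρ t, u t, θ t)`, and
`KL(law of Λ_t ‖ that reference)/(N+1) → 0`) is obtained as DOCK ∘ GRONWALL ∘ DILUTE. This file is the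
DOCK: pure statics and bookkeeping, transcribing the deterministic entropy-clock dock of route `TwoClocks`
(`EntropyClockDock.clampedWindowDock_of_gronwall`, `clampedWindowDock_of_core`, `timeZero_slice`) with
`(Φ N).lawAt λ_N t` replaced by the law of `Λ_t` under `λ_N ⊗ γ^ℕ`:

* the matrix `HU η₀` of `UniformLocalGibbsConcentration` is taken from the tree
  (`twoClocks_uniformLocalGibbsConcentration_proof`);
* at `t = 0` the law of `Λ_0` under `λ_N ⊗ γ^ℕ` IS `λ_N` (`map_lambertFlow_zero_prod`), so the
  deterministic `t = 0` slice `EntropyClockDock.timeZero_slice` transfers (`lambert_timeZero_slice`);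
* at `t > 0`: mass conservation and unit admissible mass (private re-proofs of the model's private
  lemmas), packing of `ρ_t` from `DiluteSelfConsistency` at `η = min η₁ (η₀/2)`, activity inversion
  (`exists_activity_of_density`), `η₀`-diluteness of the inverted activity, the reference tie
  (`tie_rhoLim_of_smallDensity`), exponential concentration of the reference around an anonymous density
  pinned to `ρ_t` by `data_eq_of_ties`, and the KL clause from the GRONWALL hypothesis.

prover-line-stmt-AtomisticToContinuum-11854, line Sketch, stub `stub_dockLambda`.
-/

noncomputable section

namespace Summit.AtomisticToContinuum.HydrodynamicLimit.Theorems.LambertianContactSwapLambertianEulerDock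

open scoped BigOperators Topology ENNReal InnerProductSpace
open MeasureTheory ProbabilityTheory Filter Set InformationTheory
open Literature.MathematicalPhysics.KineticTheory
open Literature.Analysis.FluidPDE Alexander

/-! ### §1 Mass conservation and unit admissible mass (PRIVATE re-proofs) -/

open Literature.Analysis.FunctionSpaces in
-- adapted from `EntropyClockDock.integral_density_eq` (Theorems/TwoClocksClampedWindowDockGronwall.lean, private)
/-- **Mass is conserved** along every classical hard-sphere-Euler solution: `∫ ρ(t) = ∫ ρ(0)` on `[0, T)` (only
the continuity equation is integrated, `∫ div = 0` on the torus). [folklore] -/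
private theorem integral_density_eq {σ T : ℝ} {ρ θ : ℝ → T3 → ℝ} {u : ℝ → T3 → V3}
    (hE : IsHardSphereEulerSolution σ T ρ u θ) {t : ℝ} (ht : t ∈ Ico 0 T) :
    ∫ x, ρ t x = ∫ x, ρ 0 x := by
  have hderiv : ∀ s ∈ Ico 0 T, HasDerivWithinAt (fun s => ∫ x, ρ s x) 0 (Ico 0 T) s := by
    intro s hs
    have h1 := hE.smooth_density.hasDerivWithinAt_integral (convex_Ico 0 T) hs
    have h2 : ∫ x, Torus.timeDerivWithin (Ico 0 T) ρ s x = 0 := by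
      have hpt : (fun x => Torus.timeDerivWithin (Ico 0 T) ρ s x) =
          fun x => -Torus.divergence (fun y => ρ s y • u s y) x := by
        funext x; have := hE.mass s hs x; linarith
      rw [hpt, integral_neg, neg_eq_zero]
      exact Torus.integral_divergence_eq_zero_holds
        ((hE.smooth_density.smul hE.smooth_velocity).isSmooth_slice hs)
    rwa [h2] at h1
  have hcont : ContinuousOn (fun s => ∫ x, ρ s x) (Icc 0 t) := fun s hs =>
    ((hderiv s ⟨hs.1, hs.2.trans_lt ht.2⟩).continuousWithinAt).mono (Icc_subset_Ico_right ht.2)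
  have hright : ∀ s ∈ Ico 0 t, HasDerivWithinAt (fun s => ∫ x, ρ s x) 0 (Ici s) s := by
    intro s hs
    have hsT : s ∈ Ico 0 T := ⟨hs.1, hs.2.trans ht.2⟩
    refine (hderiv s hsT).mono_of_mem_nhdsWithin ?_
    exact Filter.mem_of_superset (Ico_mem_nhdsGE hsT.2) (Ico_subset_Ico_left hsT.1)
  exact constant_of_has_deriv_right_zero hcont hright t (right_mem_Icc.2 ht.1)

-- adapted from `EntropyClockDock.integral_density_zero_eq_one` (ibid., private)
/-- **Admissible mass is one**: the `t = 0` tie tested with `χ ≡ 1` (empirical density identically `1`, laws of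
total mass `1` for `σ ≤ 1/2`) forces `∫ ρ(0) = 1`. [folklore] -/
private theorem integral_density_zero_eq_one {σ : ℝ} (hσ2 : σ ≤ 1 / 2) {a₀ θ₀ : T3 → ℝ} {u₀ : T3 → V3}
    (ha : Continuous a₀) (hθ : Continuous θ₀) (hu : Continuous u₀) (ha0 : ∀ x, 0 < a₀ x)
    (hθ0 : ∀ x, 0 < θ₀ x) {ρ θ : ℝ → T3 → ℝ} {u : ℝ → T3 → V3}
    (Φ : (N : ℕ) → HardSphereFlow (Torus.geometry (Fin 3)) (hsDiameter σ N) (N + 1))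
    (hA : TendstoHydroFieldsAt (fun N => localGibbsLaw σ a₀ u₀ θ₀ N (Φ N)) Φ ρ u θ 0) :
    ∫ x, ρ 0 x = 1 := by
  by_contra hne
  have hd : 0 < |1 - ∫ x, ρ 0 x| := abs_pos.2 (sub_ne_zero.2 (Ne.symm hne))
  have h := (hA (fun _ => 1) continuous_const (|1 - ∫ x, ρ 0 x| / 2) (by positivity)).1
  have hev : ∀ N : ℕ, {z : Config (N + 1) (Fin 3) T3 | |1 - ∫ x, ρ 0 x| / 2 <
      |empiricalDensityField ((Φ N).flow 0 z) (fun _ => 1) - ∫ x, (fun _ => (1 : ℝ)) x * ρ 0 x|} = univ := by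
    intro N
    ext z
    simp only [mem_setOf_eq, mem_univ, iff_true, empiricalDensityField_one (Nat.succ_ne_zero N), one_mul]
    linarith
  have hP : ∀ N, IsProbabilityMeasure (localGibbsLaw σ a₀ u₀ θ₀ N (Φ N)) :=
    fun N => isProbabilityMeasure_localGibbsLaw ha hθ hu ha0 hθ0 hσ2 N (Φ N)
  simp only [hev, measure_univ] at h
  exact one_ne_zero (tendsto_nhds_unique (tendsto_const_nhds (x := (1 : ℝ≥0∞)) (f := atTop)) h)

/-! ### §2 Time zero: the law of `Λ_0` under `λ_N ⊗ γ^ℕ` and the `t = 0` slice -/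

/-- **At time `0` the law of the Lambertian gas started from a local Gibbs law is that law**:
`(Λ_0)_* (λ_N ⊗ γ^ℕ) = λ_N` for `0 < σ < 1/2` and continuous positive profiles (`λ_N ≪ Liouville` is a
probability measure; `map_lambertFlow_zero_prod`). [folklore] -/
theorem map_lambertFlow_zero_localGibbsLaw {σ : ℝ} (hσ : 0 < σ) (hσ' : σ < 2⁻¹)
    {a₀ θ₀ : T3 → ℝ} {u₀ : T3 → V3} (ha : Continuous a₀) (hθ : Continuous θ₀) (hu : Continuous u₀)
    (ha0 : ∀ x, 0 < a₀ x) (hθ0 : ∀ x, 0 < θ₀ x) (N : ℕ)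
    (Φ : HardSphereFlow (Torus.geometry (Fin 3)) (hsDiameter σ N) (N + 1)) :
    ((localGibbsLaw σ a₀ u₀ θ₀ N Φ).prod (lambertNoise (Fin 3))).map
        (fun p => lambertFlow (Torus.geometry (Fin 3)) (hsDiameter σ N) p.2 p.1 0) =
      localGibbsLaw σ a₀ u₀ θ₀ N Φ := by
  haveI := isProbabilityMeasure_localGibbsLaw ha hθ hu ha0 hθ0 (by linarith) N Φ
  have hP : localGibbsLaw σ a₀ u₀ θ₀ N Φ ≪
      liouville (Torus.geometry (Fin 3)) (N + 1) (hsDiameter σ N) := by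
    rw [localGibbsLaw, particleLaw_eq]
    exact withDensity_absolutelyContinuous _ _
  exact map_lambertFlow_zero_prod (hsDiameter_pos hσ N) ((hsDiameter_le hσ.le N).trans_lt hσ') _ hP

/-- **The entropy clock of the Lambertian gas at time zero.** At `0 < σ < 1/2`, if the local Gibbs laws of
`(a₀, u₀, θ₀)` concentrate exponentially around `(ρ₀, ρ₀u₀, E(ρ₀,u₀,θ₀))`, every classical solution on
`[0, T)`, `0 < T`, tied to them at `t = 0` through `Φ` satisfies the `t = 0` clause of
`RelEntropyVanishingLambda`: the deterministic slice `EntropyClockDock.timeZero_slice` (data pinning, the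
reference IS the initial law) with `lawAt Φ λ_N 0 = λ_N = (Λ_0)_* (λ_N ⊗ γ^ℕ)`. [folklore] -/
theorem lambert_timeZero_slice {σ : ℝ} (hσ : 0 < σ) (hσ2 : σ < 1 / 2) {a₀ θ₀ ρ₀ : T3 → ℝ} {u₀ : T3 → V3}
    (ha : Continuous a₀) (hθ : Continuous θ₀) (hu : Continuous u₀) (ha0 : ∀ x, 0 < a₀ x) (hθ0 : ∀ x, 0 < θ₀ x)
    (hρ₀c : Continuous ρ₀) (hρ₀pos : ∀ x, 0 < ρ₀ x)
    (hconc : ∀ χ : T3 → ℝ, Continuous χ → ∀ δ : ℝ, 0 < δ → ∃ C : ℝ, 0 < C ∧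
      ∀ (N : ℕ) (Ψ : HardSphereFlow (Torus.geometry (Fin 3)) (hsDiameter σ N) (N + 1)),
        localGibbsLaw σ a₀ u₀ θ₀ N Ψ {z | δ < |empiricalDensityField z χ - ∫ x, χ x * ρ₀ x|} ≤
            ENNReal.ofReal (C * Real.exp (-(C⁻¹ * ((N : ℝ) + 1)))) ∧
          localGibbsLaw σ a₀ u₀ θ₀ N Ψ {z | δ < ‖empiricalMomentumField z χ - ∫ x, (χ x * ρ₀ x) • u₀ x‖} ≤
            ENNReal.ofReal (C * Real.exp (-(C⁻¹ * ((N : ℝ) + 1)))) ∧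
          localGibbsLaw σ a₀ u₀ θ₀ N Ψ {z | δ < |empiricalEnergyField z χ -
              ∫ x, χ x * totalEnergyDensity (ρ₀ x) (u₀ x) (θ₀ x)|} ≤
            ENNReal.ofReal (C * Real.exp (-(C⁻¹ * ((N : ℝ) + 1)))))
    {T : ℝ} {ρ θ : ℝ → T3 → ℝ} {u : ℝ → T3 → V3} (hE : IsHardSphereEulerSolution σ T ρ u θ) (hT : 0 < T)
    (Φ : (N : ℕ) → HardSphereFlow (Torus.geometry (Fin 3)) (hsDiameter σ N) (N + 1))
    (htie : TendstoHydroFieldsAt (fun N => localGibbsLaw σ a₀ u₀ θ₀ N (Φ N)) Φ ρ u θ 0) :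
    ∃ a : T3 → ℝ, (∀ N, IsProbabilityMeasure (localGibbsLaw σ a (u 0) (θ 0) N (Φ N))) ∧
      (∀ χ : T3 → ℝ, Continuous χ → ∀ δ : ℝ, 0 < δ → ∃ C : ℝ, 0 < C ∧ ∀ N : ℕ,
        localGibbsLaw σ a (u 0) (θ 0) N (Φ N) {z | δ < |empiricalDensityField z χ - ∫ x, χ x * ρ 0 x|} ≤
            ENNReal.ofReal (C * Real.exp (-(C⁻¹ * ((N : ℝ) + 1)))) ∧
          localGibbsLaw σ a (u 0) (θ 0) N (Φ N)
              {z | δ < ‖empiricalMomentumField z χ - ∫ x, (χ x * ρ 0 x) • u 0 x‖} ≤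
            ENNReal.ofReal (C * Real.exp (-(C⁻¹ * ((N : ℝ) + 1)))) ∧
          localGibbsLaw σ a (u 0) (θ 0) N (Φ N) {z | δ < |empiricalEnergyField z χ -
              ∫ x, χ x * totalEnergyDensity (ρ 0 x) (u 0 x) (θ 0 x)|} ≤
            ENNReal.ofReal (C * Real.exp (-(C⁻¹ * ((N : ℝ) + 1))))) ∧
      Tendsto (fun N : ℕ => klDiv
        (((localGibbsLaw σ a₀ u₀ θ₀ N (Φ N)).prod (lambertNoise (Fin 3))).map
          (fun p => lambertFlow (Torus.geometry (Fin 3)) (hsDiameter σ N) p.2 p.1 0))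
        (localGibbsLaw σ a (u 0) (θ 0) N (Φ N)) / ((N : ℝ≥0∞) + 1)) atTop (𝓝 0) := by
  obtain ⟨a, h1, h2, h3⟩ :=
    EntropyClockDock.timeZero_slice hσ2.le ha hθ hu ha0 hθ0 hρ₀c hρ₀pos hconc hE hT Φ htie
  refine ⟨a, h1, h2, ?_⟩
  have hσ' : σ < 2⁻¹ := by rw [inv_eq_one_div]; exact hσ2
  have he : (fun N : ℕ => klDiv
      (((localGibbsLaw σ a₀ u₀ θ₀ N (Φ N)).prod (lambertNoise (Fin 3))).map
        (fun p => lambertFlow (Torus.geometry (Fin 3)) (hsDiameter σ N) p.2 p.1 0))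
      (localGibbsLaw σ a (u 0) (θ 0) N (Φ N)) / ((N : ℝ≥0∞) + 1)) =
      fun N : ℕ => klDiv ((Φ N).lawAt (localGibbsLaw σ a₀ u₀ θ₀ N (Φ N)) 0)
        (localGibbsLaw σ a (u 0) (θ 0) N (Φ N)) / ((N : ℝ≥0∞) + 1) := by
    funext N
    rw [map_lambertFlow_zero_localGibbsLaw hσ hσ' ha hθ hu ha0 hθ0 N (Φ N),
      EntropyClockDock.lawAt_zero_localGibbsLaw]
  rw [he]
  exact h3


/-! ### §3 The dock: `GronwallCoreLambda → DiluteSelfConsistency → RelEntropyVanishingLambda` -/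

/-- **The entropy-clock DOCK of the Lambertian gas** (stub `stub_dockLambda` of line `Sketch`): Yau's node
`RelEntropyVanishingLambda` follows from its GRONWALL CORE — given the matrix of
`UniformLocalGibbsConcentration` at some `η₀` and `DiluteSelfConsistency`, for continuous positive profiles
there is `σ₀ > 0` such that for `0 < σ < σ₀`, every classical solution tied at `t = 0`, every flow family
`Φ`, every `t ∈ (0, T)` and every HANDED-OVER activity `a` with `ρ_t ≤ a ≤ 2ρ_t`,
`SmallDensity (profileOf a) σ`, `rhoLim (profileOf a) σ = ρ_t`, the specific relative entropy of the law of
`Λ_t` under `λ_N ⊗ γ^ℕ` with respect to `localGibbsLaw σ a (u t) (θ t) N (Φ N)` vanishes — and from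
`DiluteSelfConsistency` (packing `ρ_t σ³ < η` along tied classical solutions). Discharged here: the
probability clause (`σ ≤ 1/2`), the `t = 0` slice (`lambert_timeZero_slice`), the choice of `σ₀`, mass
conservation and unit mass, the packing of `ρ_t` at `η = min η₁ (η₀/2)`, the inverted activity
(`EntropyClockDock.exists_activity_of_density`) with its `η₀`-diluteness and its tie
(`EntropyClockDock.tie_rhoLim_of_smallDensity`), and the exponential concentration of the reference around
the Euler fields (the matrix of `UniformLocalGibbsConcentration` from the tree, its anonymous density pinned
to `ρ_t` by `EntropyClockDock.data_eq_of_ties`). Transcription of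
`EntropyClockDock.clampedWindowDock_of_gronwall` for the Lambertian gas. [folklore] -/
theorem stub_dockLambda :
    (∀ η₀, 0 < η₀ →
      (∀ (a θ₀ : T3 → ℝ) (u₀ : T3 → V3), Continuous a → Continuous θ₀ → Continuous u₀ → (∀ x, 0 < a x) →
        (∀ x, 0 < θ₀ x) → ∀ σ, 0 < σ → σ ^ 3 * (⨆ x, a x) ≤ η₀ * ∫ x, a x →
        ∃ ρ₀ : T3 → ℝ, Continuous ρ₀ ∧ (∀ x, 0 < ρ₀ x) ∧
          (∀ (N : ℕ) (Φ : HardSphereFlow (Torus.geometry (Fin 3)) (hsDiameter σ N) (N + 1)),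
            IsProbabilityMeasure (localGibbsLaw σ a u₀ θ₀ N Φ)) ∧
          ∀ χ : T3 → ℝ, Continuous χ → ∀ δ : ℝ, 0 < δ → ∃ C : ℝ, 0 < C ∧
            ∀ (N : ℕ) (Φ : HardSphereFlow (Torus.geometry (Fin 3)) (hsDiameter σ N) (N + 1)),
              localGibbsLaw σ a u₀ θ₀ N Φ {z | δ < |empiricalDensityField z χ - ∫ x, χ x * ρ₀ x|} ≤
                  ENNReal.ofReal (C * Real.exp (-(C⁻¹ * ((N : ℝ) + 1)))) ∧
                localGibbsLaw σ a u₀ θ₀ N Φ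
                    {z | δ < ‖empiricalMomentumField z χ - ∫ x, (χ x * ρ₀ x) • u₀ x‖} ≤
                  ENNReal.ofReal (C * Real.exp (-(C⁻¹ * ((N : ℝ) + 1)))) ∧
                localGibbsLaw σ a u₀ θ₀ N Φ {z | δ < |empiricalEnergyField z χ -
                    ∫ x, χ x * totalEnergyDensity (ρ₀ x) (u₀ x) (θ₀ x)|} ≤
                  ENNReal.ofReal (C * Real.exp (-(C⁻¹ * ((N : ℝ) + 1))))) →
      (∀ η, 0 < η → ∀ (a₀ θ₀ : T3 → ℝ) (u₀ : T3 → V3), Continuous a₀ → Continuous θ₀ → Continuous u₀ → (∀ x, 0 < a₀ x) → (∀ x, 0 < θ₀ x) → ∃ σ₀, 0 < σ₀ ∧ ∀ σ, 0 < σ → σ < σ₀ → ∀ T ρ θ u, IsHardSphereEulerSolution σ T ρ u θ → ∀ Φ : (N : ℕ) → HardSphereFlow (Torus.geometry (Fin 3)) (hsDiameter σ N) (N + 1), TendstoHydroFieldsAt (fun N => localGibbsLaw σ a₀ u₀ θ₀ N (Φ N)) Φ ρ u θ 0 → ∀ t ∈ Set.Ico 0 T, ∀ x, ρ t x * σ ^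 3 < η) →
      ∀ (a₀ θ₀ : T3 → ℝ) (u₀ : T3 → V3), Continuous a₀ → Continuous θ₀ → Continuous u₀ →
        (∀ x, 0 < a₀ x) → (∀ x, 0 < θ₀ x) →
        ∃ σ₀, 0 < σ₀ ∧ ∀ σ, 0 < σ → σ < σ₀ →
          ∀ T ρ θ u, IsHardSphereEulerSolution σ T ρ u θ →
            ∀ Φ : (N : ℕ) → HardSphereFlow (Torus.geometry (Fin 3)) (hsDiameter σ N) (N + 1),
              TendstoHydroFieldsAt (fun N => localGibbsLaw σ a₀ u₀ θ₀ N (Φ N)) Φ ρ u θ 0 →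
              ∀ t ∈ Set.Ioo 0 T, ∀ (a : T3 → ℝ) (hac : Continuous a) (hap : ∀ x, 0 < a x),
                (∀ x, ρ t x ≤ a x ∧ a x ≤ 2 * ρ t x) →
                SmallDensity (profileOf a hac hap) σ → rhoLim (profileOf a hac hap) σ = ρ t →
                Tendsto (fun N => klDiv
                  (((localGibbsLaw σ a₀ u₀ θ₀ N (Φ N)).prod (lambertNoise (Fin 3))).map
                    (fun p => lambertFlow (Torus.geometry (Fin 3)) (hsDiameter σ N) p.2 p.1 t))
                  (localGibbsLaw σ a (u t) (θ t) N (Φ N)) / ((N : ℝ≥0∞) + 1)) atTop (𝓝 0)) →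
    (∀ η, 0 < η → ∀ (a₀ θ₀ : T3 → ℝ) (u₀ : T3 → V3), Continuous a₀ → Continuous θ₀ → Continuous u₀ → (∀ x, 0 < a₀ x) → (∀ x, 0 < θ₀ x) → ∃ σ₀, 0 < σ₀ ∧ ∀ σ, 0 < σ → σ < σ₀ → ∀ T ρ θ u, IsHardSphereEulerSolution σ T ρ u θ → ∀ Φ : (N : ℕ) → HardSphereFlow (Torus.geometry (Fin 3)) (hsDiameter σ N) (N + 1), TendstoHydroFieldsAt (fun N => localGibbsLaw σ a₀ u₀ θ₀ N (Φ N)) Φ ρ u θ 0 → ∀ t ∈ Set.Ico 0 T, ∀ x, ρ t x * σ ^ 3 < η) →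
    ∀ (a₀ θ₀ : T3 → ℝ) (u₀ : T3 → V3), Continuous a₀ → Continuous θ₀ → Continuous u₀ → (∀ x, 0 < a₀ x) → (∀ x, 0 < θ₀ x) → ∃ σ₀, 0 < σ₀ ∧ ∀ σ, 0 < σ → σ < σ₀ → ∀ T ρ θ u, IsHardSphereEulerSolution σ T ρ u θ → ∀ Φ : (N : ℕ) → HardSphereFlow (Torus.geometry (Fin 3)) (hsDiameter σ N) (N + 1), (∀ N, IsProbabilityMeasure (localGibbsLaw σ a₀ u₀ θ₀ N (Φ N))) ∧ (TendstoHydroFieldsAt (fun N => localGibbsLaw σ a₀ u₀ θ₀ N (Φ N)) Φ ρ u θ 0 → ∀ t ∈ Set.Ico 0 T, ∃ a : T3 → ℝ, (∀ N, IsProbabilityMeasure (localGibbsLaw σ a (u t) (θ t) N (Φ N))) ∧ (∀ χ : T3 → ℝ, Continuous χ → ∀ δ : ℝ, 0 < δ → ∃ C : ℝ, 0 < C ∧ ∀ N : ℕ, localGibbsLaw σ a (u t) (θ t) N (Φ N) {z | δ < |empiricalDensityField z χ - ∫ x, χ x * ρ t x|} ≤ ENNReal.ofReal (C * Real.exp (-(C⁻¹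 * (N + 1)))) ∧ localGibbsLaw σ a (u t) (θ t) N (Φ N) {z | δ < ‖empiricalMomentumField z χ - ∫ x, (χ x * ρ t x) • u t x‖} ≤ ENNReal.ofReal (C * Real.exp (-(C⁻¹ * (N + 1)))) ∧ localGibbsLaw σ a (u t) (θ t) N (Φ N) {z | δ < |empiricalEnergyField z χ - ∫ x, χ x * totalEnergyDensity (ρ t x) (u t x) (θ t x)|} ≤ ENNReal.ofReal (C * Real.exp (-(C⁻¹ * (N + 1))))) ∧ Tendsto (fun N => klDiv (((localGibbsLaw σ a₀ u₀ θ₀ N (Φ N)).prod (lambertNoise (Fin 3))).map (fun p => lambertFlow (Torus.geometry (Fin 3)) (hsDiameter σ N) p.2 p.1 t)) (localGibbsLaw σ a (u t) (θ t) N (Φ N)) / ((N : ENNReal) + 1)) atTop (𝓝 0)) := by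
  intro gronwall hS a₀ θ₀ u₀ ha hθ hu ha0 hθ0
  -- the matrix of `UniformLocalGibbsConcentration` from the tree
  obtain ⟨η₀, hη₀, HU⟩ := twoClocks_uniformLocalGibbsConcentration_proof
  obtain ⟨σc, hσc, Hc⟩ := gronwall η₀ hη₀ HU hS a₀ θ₀ u₀ ha hθ hu ha0 hθ0
  -- the packing threshold of the activity inversion
  obtain ⟨η₁, hη₁, Hinv⟩ := EntropyClockDock.exists_activity_of_density
  -- dilute self-consistency at `η = min η₁ (η₀/2)`
  obtain ⟨σd, hσd, Hd⟩ := hS (min η₁ (η₀ / 2)) (lt_min hη₁ (by positivity)) a₀ θ₀ u₀ ha hθ hu ha0 hθ0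
  -- the initial activity is `η₀`-dilute for `σ ≤ min (1/2) (η₀ ∫a₀ / sup a₀)`
  have hI : 0 < ∫ x, a₀ x := integral_pos_of_continuous_pos ha ha0
  have hbdd₀ : BddAbove (Set.range a₀) := (isCompact_range ha).bddAbove
  have hSpos : 0 < ⨆ x, a₀ x := (ha0 0).trans_le (le_ciSup hbdd₀ 0)
  have hg : 0 < η₀ * (∫ x, a₀ x) / ⨆ x, a₀ x := div_pos (mul_pos hη₀ hI) hSpos
  refine ⟨min σc (min σd (min (1 / 2) (η₀ * (∫ x, a₀ x) / ⨆ x, a₀ x))),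
    lt_min hσc (lt_min hσd (lt_min (by norm_num) hg)), fun σ hσ hσlt T ρ θ u hE Φ => ?_⟩
  have hσc' : σ < σc := hσlt.trans_le (min_le_left _ _)
  have hσd' : σ < σd := hσlt.trans_le ((min_le_right _ _).trans (min_le_left _ _))
  have hσ2' : σ < 1 / 2 :=
    hσlt.trans_le ((min_le_right _ _).trans ((min_le_right _ _).trans (min_le_left _ _)))
  have hσ2 : σ ≤ 1 / 2 := hσ2'.le
  have hσg : σ ≤ η₀ * (∫ x, a₀ x) / ⨆ x, a₀ x :=
    (hσlt.trans_le ((min_le_right _ _).trans ((min_le_right _ _).trans (min_le_right _ _)))).le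
  have hguard : σ ^ 3 * (⨆ x, a₀ x) ≤ η₀ * ∫ x, a₀ x := by
    have h31 : σ ^ 3 ≤ σ := pow_le_of_le_one hσ.le (hσ2.trans (by norm_num)) three_ne_zero
    calc σ ^ 3 * (⨆ x, a₀ x) ≤ σ * ⨆ x, a₀ x := mul_le_mul_of_nonneg_right h31 hSpos.le
      _ ≤ η₀ * (∫ x, a₀ x) / (⨆ x, a₀ x) * ⨆ x, a₀ x := mul_le_mul_of_nonneg_right hσg hSpos.le
      _ = η₀ * ∫ x, a₀ x := div_mul_cancel₀ _ hSpos.ne'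
  refine ⟨fun N => isProbabilityMeasure_localGibbsLaw ha hθ hu ha0 hθ0 hσ2 N (Φ N), fun htie t ht => ?_⟩
  obtain ⟨ρ₀, hρ₀c, hρ₀pos, -, hconc⟩ := HU a₀ θ₀ u₀ ha hθ hu ha0 hθ0 σ hσ hguard
  rcases ht.1.eq_or_lt with h0 | htpos
  · subst h0
    exact lambert_timeZero_slice hσ hσ2' ha hθ hu ha0 hθ0 hρ₀c hρ₀pos hconc hE ht.2 Φ htie
  · -- the Euler slice at time `t`
    have hρtc : Continuous (ρ t) := (hE.smooth_density.isSmooth_slice ht).continuous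
    have hutc : Continuous (u t) := (hE.smooth_velocity.isSmooth_slice ht).continuous
    have hθtc : Continuous (θ t) := (hE.smooth_temperature.isSmooth_slice ht).continuous
    have hρtpos : ∀ x, 0 < ρ t x := hE.density_pos t ht
    have hθtpos : ∀ x, 0 < θ t x := hE.temperature_pos t ht
    have hmass : ∫ x, ρ t x = 1 :=
      (integral_density_eq hE ht).trans (integral_density_zero_eq_one hσ2 ha hθ hu ha0 hθ0 Φ htie)
    -- packing of `ρ_t` from dilute self-consistency
    have hpack : ∀ x, ρ t x * σ ^ 3 < min η₁ (η₀ / 2) := fun x => Hd σ hσ hσd' T ρ θ u hE Φ htie t ht x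
    have hbdd : BddAbove (Set.range (ρ t)) := (isCompact_range hρtc).bddAbove
    obtain ⟨xM, -, hxM⟩ := isCompact_univ.exists_isMaxOn univ_nonempty hρtc.continuousOn
    have hsup : (⨆ x, ρ t x) = ρ t xM :=
      le_antisymm (ciSup_le fun x => (isMaxOn_iff.mp hxM) x (mem_univ x)) (le_ciSup hbdd xM)
    have hpack₁ : σ ^ 3 * (⨆ x, ρ t x) ≤ η₁ := by
      rw [hsup, mul_comm]; exact ((hpack xM).trans_le (min_le_left _ _)).le
    have hpack₀ : σ ^ 3 * (⨆ x, ρ t x) ≤ η₀ / 2 := by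
      rw [hsup, mul_comm]; exact ((hpack xM).trans_le (min_le_right _ _)).le
    -- the inverted activity
    obtain ⟨a, hac, hap, hale, hQs, hlim⟩ := Hinv σ hσ hσ2' (ρ t) hρtc hρtpos hmass hpack₁
    -- `η₀`-diluteness of `a`: `σ³ sup a ≤ 2 σ³ sup ρ_t ≤ η₀ ≤ η₀ ∫a`
    have haguard : σ ^ 3 * (⨆ x, a x) ≤ η₀ * ∫ x, a x := by
      have hsupa : (⨆ x, a x) ≤ 2 * ⨆ x, ρ t x :=
        ciSup_le fun x => (hale x).2.trans (mul_le_mul_of_nonneg_left (le_ciSup hbdd x) zero_le_two)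
      have hinta : 1 ≤ ∫ x, a x := by
        have h := integral_mono (integrable_of_continuous_T3 hρtc) (integrable_of_continuous_T3 hac)
          fun x => (hale x).1
        linarith [hmass]
      have hσ3 : 0 ≤ σ ^ 3 := by positivity
      calc σ ^ 3 * (⨆ x, a x) ≤ σ ^ 3 * (2 * ⨆ x, ρ t x) := mul_le_mul_of_nonneg_left hsupa hσ3
        _ = 2 * (σ ^ 3 * ⨆ x, ρ t x) := by ring
        _ ≤ 2 * (η₀ / 2) := by gcongr
        _ = η₀ * 1 := by ring
        _ ≤ η₀ * ∫ x, a x := mul_le_mul_of_nonneg_left hinta hη₀.le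
    -- the reference: probability and exponential concentration around an anonymous density `ρ₁`
    obtain ⟨ρ₁, hρ₁c, hρ₁pos, hprob, hconc₁⟩ := HU a (θ t) (u t) hac hθtc hutc hap hθtpos σ hσ haguard
    -- the reference tie: `rhoLim (profileOf a) σ = ρ_t`
    have hatie : TendstoHydroFieldsAt (fun N => localGibbsLaw σ a (u t) (θ t) N (Φ N)) Φ (fun _ => ρ t)
        (fun _ => u t) (fun _ => θ t) 0 := by
      have h := EntropyClockDock.tie_rhoLim_of_smallDensity (u₀ := u t) hac hθtc hutc hap hθtpos hσ2 hQs Φ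
      simp only [hlim] at h
      exact h
    -- pin the anonymous LLN density `ρ₁` of the reference to the Euler density `ρ t`
    obtain ⟨hρt, -, -⟩ := EntropyClockDock.data_eq_of_ties hσ2 Φ hac hθtc hutc hap hθtpos hρ₁c hρ₁pos
      (EntropyClockDock.tie_of_expConc Φ hconc₁) (ρ := fun _ => ρ t) (u := fun _ => u t)
      (θ := fun _ => θ t) hρtc hutc hθtc hatie
    refine ⟨a, fun N => hprob N (Φ N), fun χ hχ δ hδ => ?_,
      Hc σ hσ hσc' T ρ θ u hE Φ htie t ⟨htpos, ht.2⟩ a hac hap hale hQs hlim⟩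
    obtain ⟨C, hC, hN⟩ := hconc₁ χ hχ δ hδ
    exact ⟨C, hC, fun N => by rw [hρt]; exact hN N (Φ N)⟩

end Summit.AtomisticToContinuum.HydrodynamicLimit.Theorems.LambertianContactSwapLambertianEulerDock

end
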